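import Summits.SmoothPoincare4.SmoothPoincare4.Theses.SblfDescent
import Summits.SmoothPoincare4.SmoothPoincare4.Theorems.SblfDescentStepTwoReduction
import Summits.SmoothPoincare4.SmoothPoincare4.Theorems.SblfDescentRungOne
import Summits.SmoothPoincare4.SmoothPoincare4.Theorems.StepTwo.Negative.SameMapObstruction
import Literature.Topology.FourManifolds.SimplifiedBrokenLefschetzFibration
import Literature.Topology.FourManifolds.GenusOneSblfOnSphereFour

/-!
# Line `two_level_flattening` on crux `SblfDescent.StepTwo` (stmt-SmoothPoincare4-18529)

Forward ladder G4 (gen 2, seed stmt-SmoothPoincare4-18530 `SblfExists`): the ROUND-CIRCLE dial at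
genus ≤ 1.  A *two-level broken Lefschetz fibration* of lower genus `h` is a broken Lefschetz fibration
over `S²` with EMBEDDED critical image (f injective on the critical set), CONNECTED fibres of genus
`h` or `h+1`, Lefschetz points only next to genus-`(h+1)` fibres, and ANY number `r ≥ 0` of round (fold)
circles; `r = 1` is the simplified class of the route (`IsSimplifiedBrokenLefschetzFibration … h`).

Skeleton (`StepTwo_of` uses the four stubs by name; `stepTwo_of_statements` is the sorry-free implication):
* `stub_genusTwoFlattens`        — GAP: a genus-2 SBLF on a homotopy 4-sphere `X` can be traded for a
                                   two-level genus-≤1 BLF on `X` (more circles, lower genus);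
* `stub_noLefschetzRecognition`  — RUNG, fold-only half (`L = ∅`; χ forces `r` odd): torus/sphere
                                   bundles over planar regions glued by round handles — recognise `S⁴`;
* `stub_lefschetzCaseRecognition` — RUNG, Lefschetz half (`L ≠ ∅`): `SL(2,ℤ)` monodromy factorisations
                                   over the genus-1 regions (`k = 2 − 2·Σ_{genus-0 R}(2 − b_R)`);
* `stub_adkGenusOneSphere`       — the Auroux–Donaldson–Katzarkov genus-1 SBLF on `S⁴` (Literature fact).
`StepTwo_of` = `helper_stepTwo_of_genusTwoRecognition` ∘ (flatten, then recognise at genus ≤ 1).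
The rung `GenusLeOneRecognition` (= both halves) sits strictly above the floor `SblfDescent.RungOne`
(`rungOne_of_genusLeOneRecognition`, Hayano 2011 Cor 4.11) and is implied by `SmoothPoincare4`.
-/

set_option linter.dupNamespace false

namespace Summit.SmoothPoincare4.SmoothPoincare4.Cruxes.StepTwo.TwoLevelFlattening

open scoped Manifold ContDiff Topology ContinuousMap
open Literature.Topology.FourManifolds
open Summit.SmoothPoincare4.SmoothPoincare4.Theses
open Summit.SmoothPoincare4.SmoothPoincare4.Theorems

/-- A **two-level broken Lefschetz fibration** of lower genus `h` on an oriented smooth 4-manifold: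
the fields `contMDiff`, `surjective`, `lefschetz`, `fold`, `injOn_crit`, `fibre`, `lefschetz_higher` of
`Literature.Topology.FourManifolds.IsSimplifiedBrokenLefschetzFibration o f L h` verbatim, WITHOUT
`isConnected_round` (one round circle), `exists_higher`, `exists_lower`: any number of round circles,
embedded critical image, connected fibres of genus `h+1` or `h`, Lefschetz points on the `h+1` side. -/
structure IsTwoLevelBrokenLefschetzFibration {X : Type} [TopologicalSpace X]
    [ChartedSpace (EuclideanSpace ℝ (Fin 4)) X] [IsManifold (𝓡 4) 1 X]
    (o : SmoothOrientation (𝓡 4) X) (f : X → Metric.sphere (0 : EuclideanSpace ℝ (Fin 3)) 1)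
    (L : Finset X) (h : ℕ) : Prop where
  contMDiff : ContMDiff (𝓡 4) (𝓡 2) ∞ f
  surjective : Function.Surjective f
  lefschetz : ∀ p ∈ L, IsLefschetzCriticalPoint (𝓡 4) (𝓡 2) o f p true
  fold : ∀ p : X, ¬ Function.Surjective (mfderiv (𝓡 4) (𝓡 2) f p) → p ∉ L →
    ∃ (φ : OpenPartialHomeomorph X (EuclideanSpace ℝ (Fin 4)))
      (ψ : OpenPartialHomeomorph (Metric.sphere (0 : EuclideanSpace ℝ (Fin 3)) 1) (EuclideanSpace ℝ (Fin 2))),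
      p ∈ φ.source ∧ φ p = 0 ∧ Set.MapsTo f φ.source ψ.source ∧
      ContMDiffOn (𝓡 4) (𝓡 4) ∞ φ φ.source ∧ ContMDiffOn (𝓡 4) (𝓡 4) ∞ φ.symm φ.target ∧
      ContMDiffOn (𝓡 2) (𝓡 2) ∞ ψ ψ.source ∧ ContMDiffOn (𝓡 2) (𝓡 2) ∞ ψ.symm ψ.target ∧
      ∀ q ∈ φ.source, (ψ (f q)) 0 = (φ q) 0 ∧ (ψ (f q)) 1 = (φ q) 1 ^ 2 + (φ q) 2 ^ 2 - (φ q) 3 ^ 2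
  injOn_crit : Set.InjOn f {p : X | ¬ Function.Surjective (mfderiv (𝓡 4) (𝓡 2) f p)}
  fibre : ∀ y, (∀ q, f q = y → Function.Surjective (mfderiv (𝓡 4) (𝓡 2) f q)) →
    IsConnected (f ⁻¹' {y}) ∧
      (Nonempty ((Fin (2 * (h + 1)) → ℤ) ≃ₗ[ℤ]
          Literature.AlgebraicTopology.SingularHomology.singularHomology ℤ ℤ ↥(f ⁻¹' {y}) 1) ∨
        Nonempty ((Fin (2 * h) → ℤ) ≃ₗ[ℤ]
          Literature.AlgebraicTopology.SingularHomology.singularHomology ℤ ℤ ↥(f ⁻¹' {y}) 1))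
  lefschetz_higher : ∀ p ∈ L, ∀ᶠ y in 𝓝 (f p),
    (∀ q, f q = y → Function.Surjective (mfderiv (𝓡 4) (𝓡 2) f q)) →
      Nonempty ((Fin (2 * (h + 1)) → ℤ) ≃ₗ[ℤ]
        Literature.AlgebraicTopology.SingularHomology.singularHomology ℤ ℤ ↥(f ⁻¹' {y}) 1)

/-- A simplified broken Lefschetz fibration is a two-level one (forget three clauses). [folklore] -/
theorem isTwoLevel_of_isSimplified {X : Type} [TopologicalSpace X]
    [ChartedSpace (EuclideanSpace ℝ (Fin 4)) X] [IsManifold (𝓡 4) 1 X]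
    {o : SmoothOrientation (𝓡 4) X} {f : X → Metric.sphere (0 : EuclideanSpace ℝ (Fin 3)) 1}
    {L : Finset X} {h : ℕ} (hf : IsSimplifiedBrokenLefschetzFibration o f L h) :
    IsTwoLevelBrokenLefschetzFibration o f L h :=
  ⟨hf.contMDiff, hf.surjective, hf.lefschetz, hf.fold, hf.injOn_crit, hf.fibre, hf.lefschetz_higher⟩

/-- Rung family: a smooth homotopy 4-sphere with a two-level BLF of lower genus `h` is `S⁴`. -/
def TwoLevelRecognition (h : ℕ) : Prop :=
  ∀ (X : Type) [TopologicalSpace X] [T2Space X] [SecondCountableTopology X]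
    [ChartedSpace (EuclideanSpace ℝ (Fin 4)) X] [IsManifold (𝓡 4) ((⊤ : ℕ∞) : WithTop ℕ∞) X],
    X ≃ₕ Metric.sphere (0 : EuclideanSpace ℝ (Fin 5)) 1 →
    (∃ (o : SmoothOrientation (𝓡 4) X) (f : X → Metric.sphere (0 : EuclideanSpace ℝ (Fin 3)) 1)
        (L : Finset X), IsTwoLevelBrokenLefschetzFibration o f L h) →
    Nonempty (Diffeomorph (𝓡 4) (𝓡 4) X (Metric.sphere (0 : EuclideanSpace ℝ (Fin 5)) 1)
      ((⊤ : ℕ∞) : WithTop ℕ∞))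

/-- THE RUNG: genus-≤1 recognition with any number of round circles. -/
def GenusLeOneRecognition : Prop := TwoLevelRecognition 0

/-- Rung, fold-only half: no Lefschetz points (`L = ∅`).  Then `χ = 2` forces
`Σ_{genus-0 regions R} (2 − b_R) = 1` (so the number of circles is odd) and the total space is a union
of torus bundles and sphere bundles over planar regions glued along round 1- and 2-handles; floor `r = 1`
is the tree fact `nonempty_diffeomorph_sphere_four_of_sblf_genus_one_noLefschetz` (Hayano 2011). -/
def NoLefschetzRecognition : Prop :=
  ∀ (X : Type) [TopologicalSpace X] [T2Space X] [SecondCountableTopology X]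
    [ChartedSpace (EuclideanSpace ℝ (Fin 4)) X] [IsManifold (𝓡 4) ((⊤ : ℕ∞) : WithTop ℕ∞) X],
    X ≃ₕ Metric.sphere (0 : EuclideanSpace ℝ (Fin 5)) 1 →
    (∃ (o : SmoothOrientation (𝓡 4) X) (f : X → Metric.sphere (0 : EuclideanSpace ℝ (Fin 3)) 1),
        IsTwoLevelBrokenLefschetzFibration o f ∅ 0) →
    Nonempty (Diffeomorph (𝓡 4) (𝓡 4) X (Metric.sphere (0 : EuclideanSpace ℝ (Fin 5)) 1)
      ((⊤ : ℕ∞) : WithTop ℕ∞))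

/-- Rung, Lefschetz half: at least one Lefschetz point.  Lefschetz values lie in genus-1 regions and
their number is `k = 2 − 2·Σ_{genus-0 R}(2 − b_R) = 2r + 2 − 4·#(genus-0 regions)` (so `r = 1 ⇒ k = 0`:
the floor is fold-only; `r = 2 ⇒` pattern (1,0,1) with `k = 2`; `r = 3` star with genus-0 centre `⇒ k = 4`); the monodromy of each genus-1 region is a
factorisation in `SL(2,ℤ) = Mod(T²)` with parabolic boundary data (Baykur–Kamada Thm 4 charts). -/
def LefschetzCaseRecognition : Prop :=
  ∀ (X : Type) [TopologicalSpace X] [T2Space X] [SecondCountableTopology X]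
    [ChartedSpace (EuclideanSpace ℝ (Fin 4)) X] [IsManifold (𝓡 4) ((⊤ : ℕ∞) : WithTop ℕ∞) X],
    X ≃ₕ Metric.sphere (0 : EuclideanSpace ℝ (Fin 5)) 1 →
    (∃ (o : SmoothOrientation (𝓡 4) X) (f : X → Metric.sphere (0 : EuclideanSpace ℝ (Fin 3)) 1)
        (L : Finset X), L.Nonempty ∧ IsTwoLevelBrokenLefschetzFibration o f L 0) →
    Nonempty (Diffeomorph (𝓡 4) (𝓡 4) X (Metric.sphere (0 : EuclideanSpace ℝ (Fin 5)) 1)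
      ((⊤ : ℕ∞) : WithTop ℕ∞))

/-- THE GAP to `StepTwo`: flatten the genus-2 region of a genus-2 SBLF on a homotopy 4-sphere into a
two-level genus-≤1 BLF of the same manifold (a consequence of `StepTwo` by transporting the ADK
fibration; as a MOVE: push the four Lefschetz points and the round circle through births / R₂-moves /
sinks so that no genus-2 fibre survives — no published algorithm lowers the top genus). -/
def GenusTwoFlattens : Prop :=
  ∀ (X : Type) [TopologicalSpace X] [T2Space X] [SecondCountableTopology X]
    [ChartedSpace (EuclideanSpace ℝ (Fin 4)) X] [IsManifold (𝓡 4) ((⊤ : ℕ∞) : WithTop ℕ∞) X],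
    X ≃ₕ Metric.sphere (0 : EuclideanSpace ℝ (Fin 5)) 1 →
    (∃ (o : SmoothOrientation (𝓡 4) X) (f : X → Metric.sphere (0 : EuclideanSpace ℝ (Fin 3)) 1)
        (L : Finset X), IsSimplifiedBrokenLefschetzFibration o f L 1) →
    ∃ (o : SmoothOrientation (𝓡 4) X) (f : X → Metric.sphere (0 : EuclideanSpace ℝ (Fin 3)) 1)
        (L : Finset X), IsTwoLevelBrokenLefschetzFibration o f L 0

/-! ## Registered stubs -/

/-- STUB (gap, hardest — no located tool): genus 2 flattens to two-level genus ≤ 1 on homotopy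
4-spheres.  Size XL.  Honours `Disproof.not_sameMap` / `Negative.SameMapObstruction`: the conclusion
asks for a NEW map. -/
theorem stub_genusTwoFlattens : GenusTwoFlattens := by
  sorry

/-- STUB (rung, fold-only half): recognise `S⁴` from a Lefschetz-free two-level genus-≤1 BLF.
Size L.  First internal target `r = 3`, pattern (0,1,0,1). -/
theorem stub_noLefschetzRecognition : NoLefschetzRecognition := by
  sorry

/-- STUB (rung, Lefschetz half): recognise `S⁴` from a two-level genus-≤1 BLF with Lefschetz points.
Size XL.  First internal target `r = 2`: pattern (1,0,1), `k = (2,0)` forced by `(−1)`-spheres vs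
`H₂ = 0`, relation `t_{c₁} t_{c₂} = −t_c^n` in `SL(2,ℤ)` with `i(c₁,c₂) = 2`. -/
theorem stub_lefschetzCaseRecognition : LefschetzCaseRecognition := by
  sorry

/-- STUB (Literature fact, Auroux–Donaldson–Katzarkov 2005 §8.2): `S⁴` carries a genus-1 simplified
broken Lefschetz fibration without Lefschetz points.  Size L (explicit map). -/
theorem stub_adkGenusOneSphere : exists_sblf_genus_one_noLefschetz_sphere_four := by
  sorry

/-! ## Sorry-free composition -/

/-- The two halves give the rung. [this file] -/
theorem genusLeOneRecognition_of_cases (h0 : NoLefschetzRecognition)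
    (h1 : LefschetzCaseRecognition) : GenusLeOneRecognition := by
  intro X _ _ _ _ _ e hX
  obtain ⟨o, f, L, hF⟩ := hX
  rcases L.eq_empty_or_nonempty with hL | hL
  · subst hL
    exact h0 X e ⟨o, f, hF⟩
  · exact h1 X e ⟨o, f, L, hL, hF⟩

/-- Rung ⇒ floor statement: one round circle is the route's `RungOne` (drop three clauses of the
inline predicate). [this file] -/
theorem rungOne_of_genusLeOneRecognition (hR : GenusLeOneRecognition) : SblfDescent.RungOne := by
  intro M _ _ _ _ _ e hM
  obtain ⟨o, f, L, h1, h2, h3, h4, h5, h6, h7, h8, h9, h10⟩ := hM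
  exact hR M e ⟨o, f, L, ⟨h1, h2, h3, h4, h6, h7, h10⟩⟩

/-- ON-PATH (F4): every rung of the family is a consequence of the summit (the fibration hypothesis
is simply discarded), so a refutation of any `TwoLevelRecognition h` exhibits an exotic 4-sphere.
[this file] -/
theorem twoLevelRecognition_of_smoothPoincare4 (hS : _root_.SmoothPoincare4) (h : ℕ) :
    TwoLevelRecognition h := by
  intro X _ _ _ _ _ e _
  exact hS X ‹_› ‹_› e

/-- Genus-2 recognition (the apex of line v3 = `StepTwo` modulo the ADK and Hayano facts) from
flattening + the rung. [this file] -/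
theorem genusTwoRecognition_of_flattens (hT : GenusTwoFlattens) (hR : GenusLeOneRecognition) :
    ∀ (X : Type) [TopologicalSpace X] [T2Space X] [SecondCountableTopology X]
      [ChartedSpace (EuclideanSpace ℝ (Fin 4)) X] [IsManifold (𝓡 4) ((⊤ : ℕ∞) : WithTop ℕ∞) X],
      X ≃ₕ Metric.sphere (0 : EuclideanSpace ℝ (Fin 5)) 1 →
      (∃ (o : SmoothOrientation (𝓡 4) X) (f : X → Metric.sphere (0 : EuclideanSpace ℝ (Fin 3)) 1)
          (L : Finset X), IsSimplifiedBrokenLefschetzFibration o f L 1) →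
      Nonempty (Diffeomorph (𝓡 4) (𝓡 4) X (Metric.sphere (0 : EuclideanSpace ℝ (Fin 5)) 1)
        ((⊤ : ℕ∞) : WithTop ℕ∞)) :=
  fun X _ _ _ _ _ e hX => hR X e (hT X e hX)

/-- **COMPOSITION / SKELETON** (kernel-checked; the only sorries are the four registered stubs, used BY
NAME): flatten (`stub_genusTwoFlattens`), recognise at genus ≤ 1 (`stub_noLefschetzRecognition`,
`stub_lefschetzCaseRecognition`), transport ADK's fibration (`stub_adkGenusOneSphere`) through the landed
reduction `helper_stepTwo_of_genusTwoRecognition` — concludes the crux BY NAME. -/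
theorem StepTwo_of : Summit.SmoothPoincare4.SmoothPoincare4.Theses.SblfDescent.StepTwo :=
  helper_stepTwo_of_genusTwoRecognition
    (genusTwoRecognition_of_flattens stub_genusTwoFlattens
      (genusLeOneRecognition_of_cases stub_noLefschetzRecognition stub_lefschetzCaseRecognition))
    stub_adkGenusOneSphere

/-- The same composition with the four stub STATEMENTS as hypotheses (sorry-free implication). -/
theorem stepTwo_of_statements :
    GenusTwoFlattens → NoLefschetzRecognition → LefschetzCaseRecognition →
      exists_sblf_genus_one_noLefschetz_sphere_four →
      Summit.SmoothPoincare4.SmoothPoincare4.Theses.SblfDescent.StepTwo :=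
  fun hT h0 h1 hADK =>
    helper_stepTwo_of_genusTwoRecognition
      (genusTwoRecognition_of_flattens hT (genusLeOneRecognition_of_cases h0 h1)) hADK

end Summit.SmoothPoincare4.SmoothPoincare4.Cruxes.StepTwo.TwoLevelFlattening
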